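import Mathlib
import HarnessLib
import Summits.ValiantsHypothesis.ValiantsHypothesis.Theorems.LacunarySymmetroidMatrixDescartesOsculationLawPeelEndMultiplicity

/-!
# ValiantsHypothesis / LacunarySymmetroid — crux `MatrixDescartes` (stmt-ValiantsHypothesis-18050, V1),
# line `Cruxes/MatrixDescartes/Lines/osculation_law.lean` («osculation-law»), stub `stub_peel` (ALL ranks):
# BRANCHES DO NOT OSCILLATE AT AN END (rank-free; the "no oscillation" end case of piece (α) of
# NOTE-p7g12-peel-general-r-sizing.md)

If a continuous solution `b = β(t)` of `Φ(t, b) = 0` on `(α, ω)`, `ω > 0`, came below `b₁` AND above `b₂ > b₁` arbitrarily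
close to `ω`, then by the intermediate value theorem every `b ∈ (b₁, b₂)` would be hit arbitrarily close to `ω`, so
(closedness) `Φ(ω, b) = 0` for a whole interval of `b`, i.e. the fibre `Φ(ω, ·)` vanishes identically — impossible when the
osculation set is finite (`not_finite_of_vanishing_fibre`).  Hence a bounded branch has one-sided LIMITS at its ends, and the
end classification (limit `0` / finite positive — then it extends, `…PeelExtend` / `+∞`) is exhaustive.

* `eval_eq_zero_of_frequently` — closedness along a frequently-hit height.
* **`not_oscillating_end`** — the statement above (as `False` from the two `∃ᶠ` hypotheses).

Honest framing: a rank-free LEMMA toward the OPEN stub `stub_peel` (all `r`); nothing of the summit is proved; `VP ≠ VNP` is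
NOT proved.  No definitions, no named facts.
-/

-- `Summit.ValiantsHypothesis.ValiantsHypothesis.…` is the tree's mandated single-conjunct layout (Sub = Summit).
set_option linter.dupNamespace false

noncomputable section

namespace Summit.ValiantsHypothesis.ValiantsHypothesis.Theorems.LacunarySymmetroidMatrixDescartes

open Polynomial Set Filter
open MvPolynomial (pderiv)
open scoped BigOperators Topology

namespace OsculationPeel

/-- Closedness: if `Φ(s, b) = 0` for `s` arbitrarily close to `ω` (from the left), then `Φ(ω, b) = 0`. [folklore] -/
theorem eval_eq_zero_of_frequently (Φ : MvPolynomial (Fin 2) ℝ) {ω b : ℝ}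
    (h : ∃ᶠ s in 𝓝[<] ω, MvPolynomial.eval ![s, b] Φ = 0) : MvPolynomial.eval ![ω, b] Φ = 0 := by
  have hc : Continuous (fun s : ℝ => MvPolynomial.eval ![s, b] Φ) :=
    Continuous.congr ((continuous_eval₂ Φ).comp₂ continuous_id continuous_const) fun _ => rfl
  have hclosed : IsClosed {s : ℝ | MvPolynomial.eval ![s, b] Φ = 0} := isClosed_eq hc continuous_const
  have hid : Tendsto (fun u : ℝ => u) (𝓝[<] ω) (𝓝 ω) := tendsto_id.mono_left nhdsWithin_le_nhds
  exact hclosed.mem_of_frequently_of_tendsto h hid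

/-- **No oscillation at an end.**  Finite osculation set; a continuous solution `β` of `Φ(t, b) = 0` on `(α, ω)`, `ω > 0`,
cannot come below `b₁` and above `b₂ > b₁` arbitrarily close to `ω`. [folklore] -/
theorem not_oscillating_end (Φ : MvPolynomial (Fin 2) ℝ) (P : ℝ → ℝ[X])
    (hP : ∀ t b, (P t).eval b = MvPolynomial.eval ![t, b] Φ)
    (hfin : {p : Fin 2 → ℝ | 0 < p 0 ∧ 0 < p 1 ∧ MvPolynomial.eval p Φ = 0 ∧
      MvPolynomial.eval p
        (MvPolynomial.X 0 * MvPolynomial.pderiv 0 (MvPolynomial.X 0 * MvPolynomial.pderiv 0 Φ)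
            * (MvPolynomial.X 1 * MvPolynomial.pderiv 1 Φ) ^ 2
          - 2 * (MvPolynomial.X 0 * MvPolynomial.pderiv 0 (MvPolynomial.X 1 * MvPolynomial.pderiv 1 Φ))
            * (MvPolynomial.X 0 * MvPolynomial.pderiv 0 Φ) * (MvPolynomial.X 1 * MvPolynomial.pderiv 1 Φ)
          + MvPolynomial.X 1 * MvPolynomial.pderiv 1 (MvPolynomial.X 1 * MvPolynomial.pderiv 1 Φ)
            * (MvPolynomial.X 0 * MvPolynomial.pderiv 0 Φ) ^ 2) = 0}.Finite)
    {α ω b₁ b₂ : ℝ} {β : ℝ → ℝ} (hω : 0 < ω) (hαω : α < ω) (hb : b₁ < b₂)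
    (hcont : ContinuousOn β (Ioo α ω)) (hsol : ∀ t ∈ Ioo α ω, MvPolynomial.eval ![t, β t] Φ = 0)
    (h₁ : ∃ᶠ t in 𝓝[<] ω, β t ≤ b₁) (h₂ : ∃ᶠ t in 𝓝[<] ω, b₂ ≤ β t) : False := by
  -- every height `b ∈ (b₁, b₂)` is hit arbitrarily close to `ω`
  have hhit : ∀ b ∈ Ioo b₁ b₂, ∃ᶠ s in 𝓝[<] ω, MvPolynomial.eval ![s, b] Φ = 0 := by
    intro b hbI
    rw [Filter.frequently_iff]
    intro U hU
    obtain ⟨l, hl, hlU⟩ := mem_nhdsLT_iff_exists_Ioo_subset.1 hU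
    -- work inside `Ioo l' ω`, `l' = max l α`
    have hl' : max l α < ω := max_lt hl hαω
    have hmem : Ioo (max l α) ω ∈ 𝓝[<] ω := Ioo_mem_nhdsLT hl'
    obtain ⟨t', ht'β, ht'I⟩ := (h₁.and_eventually hmem).exists
    obtain ⟨t'', ht''β, ht''I⟩ := (h₂.and_eventually hmem).exists
    have hsubαω : ∀ u, min t' t'' ≤ u → u ≤ max t' t'' → u ∈ Ioo α ω := fun u hu1 hu2 =>
      ⟨lt_of_lt_of_le (lt_min ((le_max_right _ _).trans_lt ht'I.1) ((le_max_right _ _).trans_lt ht''I.1)) hu1,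
        lt_of_le_of_lt hu2 (max_lt ht'I.2 ht''I.2)⟩
    have hsubU : ∀ u, min t' t'' ≤ u → u ≤ max t' t'' → u ∈ U := fun u hu1 hu2 =>
      hlU ⟨lt_of_lt_of_le (lt_min ((le_max_left _ _).trans_lt ht'I.1) ((le_max_left _ _).trans_lt ht''I.1)) hu1,
        lt_of_le_of_lt hu2 (max_lt ht'I.2 ht''I.2)⟩
    -- IVT on the segment between `t'` and `t''`
    rcases le_total t' t'' with hle | hle
    · have hc : ContinuousOn β (Icc t' t'') := hcont.mono fun u hu =>
        hsubαω u (by rw [min_eq_left hle]; exact hu.1) (by rw [max_eq_right hle]; exact hu.2)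
      obtain ⟨s, hs, hsb⟩ := intermediate_value_Icc hle hc ⟨ht'β.trans hbI.1.le, hbI.2.le.trans ht''β⟩
      refine ⟨s, hsubU s (by rw [min_eq_left hle]; exact hs.1) (by rw [max_eq_right hle]; exact hs.2), ?_⟩
      rw [← hsb]
      exact hsol s (hsubαω s (by rw [min_eq_left hle]; exact hs.1) (by rw [max_eq_right hle]; exact hs.2))
    · have hc : ContinuousOn β (Icc t'' t') := hcont.mono fun u hu =>
        hsubαω u (by rw [min_eq_right hle]; exact hu.1) (by rw [max_eq_left hle]; exact hu.2)
      obtain ⟨s, hs, hsb⟩ := intermediate_value_Icc' hle hc ⟨ht'β.trans hbI.1.le, hbI.2.le.trans ht''β⟩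
      refine ⟨s, hsubU s (by rw [min_eq_right hle]; exact hs.1) (by rw [max_eq_left hle]; exact hs.2), ?_⟩
      rw [← hsb]
      exact hsol s (hsubαω s (by rw [min_eq_right hle]; exact hs.1) (by rw [max_eq_left hle]; exact hs.2))
  -- hence `Φ(ω, b) = 0` on `(b₁, b₂)`: the fibre vanishes
  have hroots : ∀ b ∈ Ioo b₁ b₂, (P ω).IsRoot b := fun b hbI => by
    rw [IsRoot, hP]; exact eval_eq_zero_of_frequently Φ (hhit b hbI)
  have hP0 : P ω = 0 :=
    Polynomial.eq_zero_of_infinite_isRoot _ ((Set.Ioo_infinite hb).mono fun b hbI => hroots b hbI)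
  exact not_finite_of_vanishing_fibre Φ P hP hω hP0 hfin

end OsculationPeel

end Summit.ValiantsHypothesis.ValiantsHypothesis.Theorems.LacunarySymmetroidMatrixDescartes

end
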